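import Summits.AtomisticToContinuum.BoseEinsteinCondensation.Theorems.BECConjugateDominationHardCoreExtensionResidue
import HarnessLib

/-!
# The hard-sphere gas condenses modulo S2, S3, Lemma G and the boundary transfer
# (line `third-law-current-floor`, crux `BECConjugateDomination.HardCoreExtension`, stmt-AtomisticToContinuum-11786 — lead c5)

The headline instance of the landed composition `…HardCoreExtensionResidue.lean` for the potential the crux exists for:
`hardCorePotential a = ⊤·1_{[0,a)}` (hard spheres of diameter `a > 0`, LSSY Ch. 2 after (2.1)). It is of the line's
hard-core class (`⊤` on `[0,a)`, bounded — indeed `0` — on every `(a',∞)`, `a' > a`), so the exotic residue is NOT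
involved: modulo the route's infrared mechanism made `R`-uniform over bounded potentials (S2 `stub_forceStructureBound`,
S3 `stub_uniformLevyBound`) and the dilute hard-sphere connectivity conjecture G (`stub_lemmaGConnected` = Disproof §13
`LemmaGConnected`), the periodic hard-sphere gas has near-minimiser BEC at every small density
(`periodicBEC_hardSpheres_of_bounds_of_lemmaG`), and with the shared crux `BoundaryTransferWeak` (stmt-0827) the
Dirichlet ground state condenses, `HasGroundStateBEC (hardCorePotential a) ρ` for `0 < ρ < ρ₀(a)`
(`diluteBEC_hardSpheres_of_bounds_of_lemmaG`). Compare the landed obstruction at high density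
(`Negative/HighDensityObstruction.lean`: no BEC for `ρ > 8/a³`).

References: E. H. Lieb, R. Seiringer, J. P. Solovej, J. Yngvason, *The Mathematics of the Bose Gas and its Condensation*
(2005), §1.2 (1.19), Ch. 2 (2.1), Ch. 5 p. 42; Y. Baryshnikov, P. Bubenik, M. Kahle, IMRN 2014 §6.
-/

noncomputable section

namespace Summit.AtomisticToContinuum.BoseEinsteinCondensation.Cruxes.HardCoreExtension.ThirdLawCurrentFloorAlt

open MeasureTheory Filter
open scoped ENNReal NNReal BigOperators Topology
open Literature.MathematicalPhysics.QuantumManyBody.BoseGas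
open Summit.AtomisticToContinuum.BoseEinsteinCondensation.Theses.BECConjugateDomination

/-- **The hard-sphere potential is of the line's hard-core class**: `⊤` on `[0,a)` and bounded (by `0`) on every
`(a',∞)` with `a' > a`. [cite: LSSY2005, Ch. 2, paragraph after eq. (2.1)] -/
theorem hardCorePotential_mem_hardCoreClass {a : ℝ} (ha : 0 < a) :
    ∃ a₀ : ℝ, 0 < a₀ ∧ (∀ r : ℝ, 0 ≤ r → r < a₀ → hardCorePotential a r = ⊤) ∧
      ∀ a' : ℝ, a₀ < a' → ∃ M : ℝ≥0∞, M ≠ ⊤ ∧ ∀ r : ℝ, a' < r → hardCorePotential a r ≤ M :=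
  ⟨a, ha, fun _ _ hr => hardCorePotential_of_lt hr, fun _ ha' =>
    ⟨0, ENNReal.zero_ne_top, fun _ hr => (hardCorePotential_of_le (ha'.trans hr).le).le⟩⟩

section Residue

variable
  (hS2 : ∀ R : ℝ, 0 < R → ∃ C : ℝ, 0 < C ∧ ∃ ρ₀ : ℝ, 0 < ρ₀ ∧ ∀ ρ : ℝ, 0 < ρ → ρ < ρ₀ →
    ∀ᶠ n : ℕ in atTop, ∀ v : ℝ → ℝ≥0∞, IsRepulsiveFiniteRange v →
    (∃ M : ℝ≥0∞, M ≠ ⊤ ∧ ∀ r, v r ≤ M) → (∀ r, R < r → v r = 0) →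
    ∀ Ψ : PeriodicTrialState (n + 1) (sideLength ρ (n + 1)),
    periodicEnergy v Ψ = periodicGroundStateEnergy v (n + 1) (sideLength ρ (n + 1)) →
    periodicEnergy v Ψ ≠ ⊤ → (∀ X, Ψ.ψ X = (‖Ψ.ψ X‖ : ℂ)) → (∀ X, Ψ.ψ X ≠ 0) →
    ∀ m : Fin 3 → ℤ, m ≠ 0 →
    (∫ X in cellN (n + 1) (sideLength ρ (n + 1)),
    ‖∑ j : Fin (n + 1), cellWave (sideLength ρ (n + 1)) m (X j) *
    fderiv ℝ Ψ.ψ X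
    (Pi.single j ((2 * Real.pi / sideLength ρ (n + 1)) • latticeVec 1 m))‖ ^ 2) ≤
    C * ρ * ‖(2 * Real.pi / sideLength ρ (n + 1)) • latticeVec 1 m‖ ^ 2 * ((n : ℝ) + 1))
  (hS3 : ∀ R : ℝ, 0 < R → ∃ C : ℝ, 0 ≤ C ∧ ∃ ρ₀ : ℝ, 0 < ρ₀ ∧ ∀ ρ : ℝ, 0 < ρ → ρ < ρ₀ →
    ∀ᶠ n : ℕ in atTop, ∀ v : ℝ → ℝ≥0∞, IsRepulsiveFiniteRange v →
    (∃ M : ℝ≥0∞, M ≠ ⊤ ∧ ∀ r, v r ≤ M) → (∀ r, R < r → v r = 0) →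
    ∀ Ψ : PeriodicTrialState (n + 1) (sideLength ρ (n + 1)),
    (let L : ℝ := sideLength ρ (n + 1)
    let g : Space → ℝ := fun r => ∫ x in cell L, ∫ Y in cellN n L,
    ‖Ψ.ψ (Matrix.vecCons (x + r) Y)‖ * ‖Ψ.ψ (Matrix.vecCons x Y)‖
    let ν : (Fin 3 → ℤ) → ℝ := fun m =>
    (cellFourierCoeff L (fun r : Space => ((Real.log (g r) : ℝ) : ℂ)) m).re
    let S : (Fin 3 → ℤ) → ℝ := fun m => ((n : ℝ) + 1)⁻¹ *
    ∫ X in cellN (n + 1) L, ‖∑ j : Fin (n + 1), cellWave L m (X j)‖ ^ 2 * ‖Ψ.ψ X‖ ^ 2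
    periodicEnergy v Ψ = periodicGroundStateEnergy v (n + 1) L → periodicEnergy v Ψ ≠ ⊤ →
    (∀ X, Ψ.ψ X = (‖Ψ.ψ X‖ : ℂ)) → (∀ X, Ψ.ψ X ≠ 0) →
    ∀ m : Fin 3 → ℤ, m ≠ 0 → ((n : ℝ) + 1) * ν m * S m ≤ C))
  (hG : ∀ b : ℝ, 0 < b → ∃ ρ₁ : ℝ, 0 < ρ₁ ∧ ∀ ρ : ℝ, 0 < ρ → ρ < ρ₁ → ∀ᶠ N : ℕ in atTop,
      ∀ X ∈ {X : Config N | ∀ i j : Fin N, i ≠ j → ∀ n : Fin 3 → ℤ, b < ‖X i - X j - latticeVec (sideLength ρ N) n‖},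
        ∀ Y ∈ {X : Config N | ∀ i j : Fin N, i ≠ j → ∀ n : Fin 3 → ℤ, b < ‖X i - X j - latticeVec (sideLength ρ N) n‖},
          ∃ σ : Equiv.Perm (Fin N),
            JoinedIn {X : Config N | ∀ i j : Fin N, i ≠ j → ∀ n : Fin 3 → ℤ,
              b < ‖X i - X j - latticeVec (sideLength ρ N) n‖} X (Y ∘ σ))

include hS2 hS3 hG in
/-- **Near-minimiser periodic BEC of the hard-sphere gas [S2, S3, G]**: for every diameter `a > 0` there is `ρ₀ > 0`
such that for `0 < ρ < ρ₀` some `c > 0` bounds the constant-mode occupation of every `δ_N`-near-minimiser on the torus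
of side `(N/ρ)^{1/3}` below by `cN`, for all large `N` (verbatim the hypothesis of `BoundaryTransferWeak (hardCorePotential a)`).
[cite: LSSY2005, §1.2 (1.19) and Ch. 5 p. 42; BaryshnikovBubenikKahle2014, §6] -/
theorem periodicBEC_hardSpheres_of_bounds_of_lemmaG {a : ℝ} (ha : 0 < a) :
    ∃ ρ₀ : ℝ, 0 < ρ₀ ∧ ∀ ρ : ℝ, 0 < ρ → ρ < ρ₀ → ∃ c : ℝ, 0 < c ∧ ∀ᶠ N : ℕ in atTop,
      ∃ δ : ℝ≥0∞, 0 < δ ∧ ∀ Ψ : PeriodicTrialState N (sideLength ρ N),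
        periodicEnergy (hardCorePotential a) Ψ ≤
            periodicGroundStateEnergy (hardCorePotential a) N (sideLength ρ N) + δ →
        ENNReal.ofReal (c * N) ≤ condensateOccupation N (sideLength ρ N) Ψ.ψ :=
  periodicBEC_of_bounds_of_lemmaG_of_hardCore hS2 hS3 hG (hardCorePotential a) (isRepulsiveFiniteRange_hardCorePotential a)
    (hardCorePotential_mem_hardCoreClass ha)

end Residue

/-- **Dilute ground-state BEC of the hard-sphere gas modulo S2, S3, G and `BoundaryTransferWeak`**: for every diameter
`a > 0` there is `ρ₀ > 0` with `HasGroundStateBEC (hardCorePotential a) ρ` for all `0 < ρ < ρ₀` — the Dirichlet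
conjunct's statement for hard spheres, modulo the route's `R`-uniform infrared mechanism (S2 `stub_forceStructureBound`,
S3 `stub_uniformLevyBound`), the dilute connectivity conjecture G (`stub_lemmaGConnected`) and the shared boundary transfer
(stmt-0827). (At high density it is FALSE: `Negative.not_hasGroundStateBEC_hardCorePotential`, `ρ > 8/a³`.)
[cite: LSSY2005, §1.2 (1.19) and Ch. 5 p. 42; BaryshnikovBubenikKahle2014, §6] -/
theorem diluteBEC_hardSpheres_of_bounds_of_lemmaG :
    (∀ R : ℝ, 0 < R → ∃ C : ℝ, 0 < C ∧ ∃ ρ₀ : ℝ, 0 < ρ₀ ∧ ∀ ρ : ℝ, 0 < ρ → ρ < ρ₀ →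
    ∀ᶠ n : ℕ in atTop, ∀ v : ℝ → ℝ≥0∞, IsRepulsiveFiniteRange v →
    (∃ M : ℝ≥0∞, M ≠ ⊤ ∧ ∀ r, v r ≤ M) → (∀ r, R < r → v r = 0) →
    ∀ Ψ : PeriodicTrialState (n + 1) (sideLength ρ (n + 1)),
    periodicEnergy v Ψ = periodicGroundStateEnergy v (n + 1) (sideLength ρ (n + 1)) →
    periodicEnergy v Ψ ≠ ⊤ → (∀ X, Ψ.ψ X = (‖Ψ.ψ X‖ : ℂ)) → (∀ X, Ψ.ψ X ≠ 0) →
    ∀ m : Fin 3 → ℤ, m ≠ 0 →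
    (∫ X in cellN (n + 1) (sideLength ρ (n + 1)),
    ‖∑ j : Fin (n + 1), cellWave (sideLength ρ (n + 1)) m (X j) *
    fderiv ℝ Ψ.ψ X
    (Pi.single j ((2 * Real.pi / sideLength ρ (n + 1)) • latticeVec 1 m))‖ ^ 2) ≤
    C * ρ * ‖(2 * Real.pi / sideLength ρ (n + 1)) • latticeVec 1 m‖ ^ 2 * ((n : ℝ) + 1)) →
    (∀ R : ℝ, 0 < R → ∃ C : ℝ, 0 ≤ C ∧ ∃ ρ₀ : ℝ, 0 < ρ₀ ∧ ∀ ρ : ℝ, 0 < ρ → ρ < ρ₀ →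
    ∀ᶠ n : ℕ in atTop, ∀ v : ℝ → ℝ≥0∞, IsRepulsiveFiniteRange v →
    (∃ M : ℝ≥0∞, M ≠ ⊤ ∧ ∀ r, v r ≤ M) → (∀ r, R < r → v r = 0) →
    ∀ Ψ : PeriodicTrialState (n + 1) (sideLength ρ (n + 1)),
    (let L : ℝ := sideLength ρ (n + 1)
    let g : Space → ℝ := fun r => ∫ x in cell L, ∫ Y in cellN n L,
    ‖Ψ.ψ (Matrix.vecCons (x + r) Y)‖ * ‖Ψ.ψ (Matrix.vecCons x Y)‖
    let ν : (Fin 3 → ℤ) → ℝ := fun m =>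
    (cellFourierCoeff L (fun r : Space => ((Real.log (g r) : ℝ) : ℂ)) m).re
    let S : (Fin 3 → ℤ) → ℝ := fun m => ((n : ℝ) + 1)⁻¹ *
    ∫ X in cellN (n + 1) L, ‖∑ j : Fin (n + 1), cellWave L m (X j)‖ ^ 2 * ‖Ψ.ψ X‖ ^ 2
    periodicEnergy v Ψ = periodicGroundStateEnergy v (n + 1) L → periodicEnergy v Ψ ≠ ⊤ →
    (∀ X, Ψ.ψ X = (‖Ψ.ψ X‖ : ℂ)) → (∀ X, Ψ.ψ X ≠ 0) →
    ∀ m : Fin 3 → ℤ, m ≠ 0 → ((n : ℝ) + 1) * ν m * S m ≤ C)) →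
    (∀ b : ℝ, 0 < b → ∃ ρ₁ : ℝ, 0 < ρ₁ ∧ ∀ ρ : ℝ, 0 < ρ → ρ < ρ₁ → ∀ᶠ N : ℕ in atTop,
      ∀ X ∈ {X : Config N | ∀ i j : Fin N, i ≠ j → ∀ n : Fin 3 → ℤ, b < ‖X i - X j - latticeVec (sideLength ρ N) n‖},
        ∀ Y ∈ {X : Config N | ∀ i j : Fin N, i ≠ j → ∀ n : Fin 3 → ℤ, b < ‖X i - X j - latticeVec (sideLength ρ N) n‖},
          ∃ σ : Equiv.Perm (Fin N),
            JoinedIn {X : Config N | ∀ i j : Fin N, i ≠ j → ∀ n : Fin 3 → ℤ,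
              b < ‖X i - X j - latticeVec (sideLength ρ N) n‖} X (Y ∘ σ)) →
    BoundaryTransferWeak → ∀ a : ℝ, 0 < a →
    ∃ ρ₀ : ℝ, 0 < ρ₀ ∧ ∀ ρ : ℝ, 0 < ρ → ρ < ρ₀ → HasGroundStateBEC (hardCorePotential a) ρ :=
  fun hS2 hS3 hG hbt a ha =>
    hbt _ (isRepulsiveFiniteRange_hardCorePotential a) (periodicBEC_hardSpheres_of_bounds_of_lemmaG hS2 hS3 hG ha)


end Summit.AtomisticToContinuum.BoseEinsteinCondensation.Cruxes.HardCoreExtension.ThirdLawCurrentFloorAlt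

end
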